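import Literature.Probability.Percolation.FourArmGarbanMonotone
import HarnessLib

/-!
# Trimming an open lattice path to an exact annulus crossing (bond `ℤ²`)

Topic `Literature/Probability/Percolation`; proofs only, next to `FourArmGarbanMonotone.lean`
(whose `exists_openConnIn_sqAnnulus_of_le_left/right` trim an open crossing of `A_{m,n}` that
already starts and ends on the boundary spheres).  When open lattice paths are obtained as
shadows of continuum arms (Schramm–Smirnov, *On the scaling limits of planar percolation* (2011),
§2, proof of Thm. 1.1: "in `ω_j` we have the four arm event from `∂B_j` to `∂Q₀`";
`openConnIn_of_isPreconnected_subset_openEdgeUnion`, `OpenPathAnnulusCrossing.lean`) their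
endpoints are only known to lie INSIDE `B(m₁)` and OUTSIDE `B(n₁ - 1)`; to feed the cluster-form
four-arm event `fourArmTwoClusters m₁ n₁` of `FourArmGarban.lean` one trims:

* `mem_box_add_one_of_adj` — a neighbour of a site of `B(k)` lies in `B(k+1)`;
* `exists_openConnIn_sqAnnulus_of_openConnIn` — **an open path (inside any vertex set `S`) from
  a site of `B(m₁)` to a site off `B(n₁ - 1)`, `1 ≤ m₁ ≤ n₁`, contains an open crossing of the
  annulus `A_{m₁,n₁}` from a site `x'` with `‖x'‖_∞ = m₁` to a site with `‖·‖_∞ = n₁`**, with `x'`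
  on the original path (so `x ↔ x'` in `S`): keep the part after the last visit to `B(m₁ - 1)`,
  then stop at the first exit from `B(n₁ - 1)` (`exists_prefix_exit`).

## References

* O. Schramm, S. Smirnov, Ann. Probab. 39 (2011), §2 (proof of Thm. 1.1). [SchrammSmirnov2011]
* J. van den Berg, P. Nolin, Progr. Probab. 77 (2020), §2 (arm events of `A_{n₁,n₂}`).
  [VandenbergNolin2020]

Tree: `siteSphere`, `sqAnnulus` (`FourArmGarban.lean`), `exists_prefix_exit`
(`FourArmGarbanTwoArms.lean`), `exists_walk_of_mem_openConnIn`, `mem_openConnIn_of_walk`,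
`mem_openConnIn_of_mem_support`, `openConnIn_refl` (`PlanarDuality.lean`), `mem_box`, `box_mono`,
`mem_annulus`, `zdGraph_adj_iff`.
-/

noncomputable section

namespace Literature.Probability.Percolation

open Set LatticeModels

/-- A neighbour of a site of `B(k)` lies in `B(k+1)` (`ℤ²`). [folklore] -/
theorem mem_box_add_one_of_adj {k : ℕ} {x z : Site 2} (hx : x ∈ box 2 k)
    (h : (zdGraph 2).Adj x z) : z ∈ box 2 (k + 1) := by
  rw [mem_box] at hx ⊢
  obtain ⟨j, hj | hj⟩ := (zdGraph_adj_iff x z).1 h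
  · intro i
    have h2 := hx i
    have h3 : z i = x i + (Pi.single j (1 : ℤ) : Site 2) i := by rw [hj]; rfl
    rw [Pi.single_apply] at h3
    push_cast
    split_ifs at h3 <;> omega
  · intro i
    have h2 := hx i
    have h3 : x i = z i + (Pi.single j (1 : ℤ) : Site 2) i := by rw [hj]; rfl
    rw [Pi.single_apply] at h3
    push_cast
    split_ifs at h3 <;> omega

/-- **Trimming an open path to an exact annulus crossing.**  On a lattice configuration, if `x ↔ y`
by an open path inside `S`, `x ∈ B(m₁)`, `y ∉ B(n₁ - 1)` and `1 ≤ m₁ ≤ n₁`, then some `x'` with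
`‖x'‖_∞ = m₁` on that path (`x ↔ x'` in `S`) is joined inside the annulus `A_{m₁,n₁}` by an open
path to a site `y'` with `‖y'‖_∞ = n₁`. [cite: VandenbergNolin2020, §2 (monotonicity of arm events in the radii)] -/
theorem exists_openConnIn_sqAnnulus_of_openConnIn {ω : BondConfig (Site 2)}
    (hω : ω ⊆ (zdGraph 2).edgeSet) {S : Set (Site 2)} {x y : Site 2} (h : ω ∈ openConnIn S x y)
    {m₁ n₁ : ℕ} (hm : 1 ≤ m₁) (hmn : m₁ ≤ n₁) (hx : x ∈ box 2 m₁) (hy : y ∉ box 2 (n₁ - 1)) :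
    ∃ x' ∈ siteSphere m₁, ∃ y' ∈ siteSphere n₁,
      ω ∈ openConnIn (sqAnnulus m₁ n₁) x' y' ∧ ω ∈ openConnIn S x x' := by
  classical
  obtain ⟨p, hps, hpe⟩ := exists_walk_of_mem_openConnIn hω h
  have hyb : y ∉ box 2 (m₁ - 1) := fun h' => hy (box_mono 2 (by omega) h')
  -- Step A: after the last visit to `B(m₁ - 1)`
  have stepA : ∃ (x' : Site 2) (q : (zdGraph 2).Walk x' y), x' ∈ siteSphere m₁ ∧
      (∀ v ∈ q.support, v ∉ box 2 (m₁ - 1)) ∧ (∀ e ∈ q.edges, e ∈ ω) ∧ x' ∈ p.support := by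
    by_cases hall : ∀ u ∈ p.support, u ∉ box 2 (m₁ - 1)
    · exact ⟨x, p, Finset.mem_sdiff.2 ⟨hx, hall x p.start_mem_support⟩, hall, hpe,
        p.start_mem_support⟩
    · push Not at hall
      obtain ⟨u, hu, hub⟩ := hall
      set p₂ := p.dropUntil u hu with hp₂
      have hp₂s : ∀ v ∈ p₂.support, v ∈ p.support := fun v hv =>
        p.support_dropUntil_subset_support hu hv
      have hp₂e : ∀ e ∈ p₂.edges, e ∈ p.edges := fun e he => p.edges_dropUntil_subset_edges hu he
      have hyA : y ∈ ({v | v ∉ box 2 (m₁ - 1)} : Set (Site 2)) := hyb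
      have huA : u ∉ ({v | v ∉ box 2 (m₁ - 1)} : Set (Site 2)) := fun h' => h' hub
      obtain ⟨x', z', q₃, hx'z', hz', hA', hS', hE', -⟩ :=
        exists_prefix_exit (A := {v | v ∉ box 2 (m₁ - 1)}) p₂.reverse hyA huA
      have hz'box : z' ∈ box 2 (m₁ - 1) := not_not.1 hz'
      have hx'box : x' ∈ box 2 m₁ := by
        have := mem_box_add_one_of_adj hz'box hx'z'.symm
        rwa [Nat.sub_add_cancel hm] at this
      refine ⟨x', q₃.reverse, Finset.mem_sdiff.2 ⟨hx'box, hA' x' q₃.end_mem_support⟩, ?_, ?_, ?_⟩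
      · intro v hv
        rw [SimpleGraph.Walk.support_reverse, List.mem_reverse] at hv
        exact hA' v hv
      · intro e he
        rw [SimpleGraph.Walk.edges_reverse, List.mem_reverse] at he
        have h1 := hE' e he
        rw [SimpleGraph.Walk.edges_reverse, List.mem_reverse] at h1
        exact hpe e (hp₂e e h1)
      · have h1 := hS' x' q₃.end_mem_support
        rw [SimpleGraph.Walk.support_reverse, List.mem_reverse] at h1
        exact hp₂s x' h1
  obtain ⟨x', q, hx's, hqA, hqe, hx'p⟩ := stepA
  have hxx' : ω ∈ openConnIn S x x' := mem_openConnIn_of_mem_support p hps hpe hx'p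
  have hx'box : x' ∈ box 2 m₁ := (Finset.mem_sdiff.1 hx's).1
  -- Step B: stop at the first exit from `B(n₁ - 1)`
  by_cases hx'b : x' ∈ box 2 (n₁ - 1)
  · have hx'A : x' ∈ (↑(box 2 (n₁ - 1)) : Set (Site 2)) := Finset.mem_coe.2 hx'b
    have hyA : y ∉ (↑(box 2 (n₁ - 1)) : Set (Site 2)) := fun h' => hy (Finset.mem_coe.1 h')
    obtain ⟨x'', z, q₁, hxz, hz, hA, hS, hE, hlast⟩ := exists_prefix_exit q hx'A hyA
    have hzb : z ∈ box 2 n₁ := by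
      have := mem_box_add_one_of_adj (Finset.mem_coe.1 (hA x'' q₁.end_mem_support)) hxz
      rwa [Nat.sub_add_cancel (hm.trans hmn)] at this
    have hzs : z ∈ siteSphere n₁ := Finset.mem_sdiff.2 ⟨hzb, fun h' => hz (Finset.mem_coe.2 h')⟩
    have hzq : z ∈ q.support := q.snd_mem_support_of_mem_edges hlast
    refine ⟨x', hx's, z, hzs, mem_openConnIn_of_walk (q₁.concat hxz) (fun v hv => ?_)
      (fun e he => ?_), hxx'⟩
    · rw [SimpleGraph.Walk.support_concat, List.mem_append, List.mem_singleton] at hv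
      simp only [sqAnnulus, Finset.mem_coe, mem_annulus]
      rcases hv with hv | rfl
      · exact ⟨box_mono 2 (Nat.sub_le n₁ 1) (Finset.mem_coe.1 (hA v hv)), hqA v (hS v hv)⟩
      · exact ⟨hzb, hqA _ hzq⟩
    · rw [SimpleGraph.Walk.edges_concat, List.concat_eq_append, List.mem_append,
        List.mem_singleton] at he
      rcases he with he | rfl
      · exact hqe e (hE e he)
      · exact hqe _ hlast
  · -- `x'` already lies on the sphere `‖·‖_∞ = n₁`
    have hx'n : x' ∈ siteSphere n₁ := Finset.mem_sdiff.2 ⟨box_mono 2 hmn hx'box, hx'b⟩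
    exact ⟨x', hx's, x', hx'n, openConnIn_refl (mem_sqAnnulus_of_mem_siteSphere hmn hx's), hxx'⟩

end Literature.Probability.Percolation

end
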